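import Literature.RingTheory.KTheory.MilnorKWittRingResidue
import Literature.RingTheory.KTheory.MilnorKRatFuncBoundary
import HarnessLib

/-!
# The residue homomorphisms `∂_π : W(F(t)) → W(F[t]/π)` and the left-split complex
# `0 → W(F) → W(F(t)) → ⊕_π W(F[t]/π)` — Milnor, *Algebraic K-theory and quadratic forms*, Invent. Math. 9 (1970),
# §5, Theorem 5.3 (the maps and the complex) and Lemma 5.4 (`W(F) ↪ W(F(t))` is a retract under `ρ`)

Family `hodge`, lane `lit-hodgefound` (foundations library; seat `lit-hodgefound-p27`, generation 41, row g41-#7);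
topic `RingTheory/KTheory`.  Sequel of `MilnorKWittRingResidue` (g41-#6: for a discrete valuation `v` with prime `π`
the second residue homomorphism `sndResidue v hπ = ∂ : W(K) →+ W(K̄)`, `∂(u) = 0`, `∂(πu) = (ū)`, Lemma 5.4's ring
homomorphism `rho`, functoriality `WittRing.map`) and of the `F(t)` set-up of g39/g40 (`RatFuncPrimeTameSymbols`:
the primes `𝔭` of `F[t]` with monic generators `monicGen F 𝔭`, `polyUnit`, `genUnit`, `addVal_monicGen`;
`TameSymbolDedekind`: the residue fields `ResidueFieldAt F[t] F(t) 𝔭 ≅ F[t]/𝔭`, `toResidueFieldAt`,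
`finite_setOf_addVal_ne_zero`; `MilnorKRatFuncBoundary`: the degree-one prime `primeT = (t)` and the same complex for
Milnor `K`-theory, Theorem 2.3).  DEFINITIONS WITH BODIES and PROVED THEOREMS; no named fact, no instance, no
notation, 0 `sorry`, net debt 0 (D-0026).

## The source, verbatim

J. Milnor, *Algebraic K-theory and quadratic forms*, Invent. Math. 9 (1970) 318–344 (held `paper:doi-10-1007-bf01425486`;
bib key `Milnor1970`), §5 (p0018 L5–L15): «Now consider a field E = F(t) of rational functions. For each monic
irreducible π ∈ F[t] we can form the π-adic completion E_π, with residue class field Ē_π = F[t]/(π). Let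
∂_π : WE → WĒ_π denote the composition of the natural map WE → WE_π with the homomorphism ∂ of 5.1. Evidently
∂_π(u) = 0 and ∂_π(πu) = (ū). THEOREM 5.3. These homomorphisms ∂_π give rise to a split exact sequence
0 → WF → WE → ⊕ WĒ_π → 0, where E = F(t), and where the summation extends over all monic irreducible polynomials π
in F[t].»  (p0018 L19–L44): «Let L_d ⊂ WE denote the subring generated by all (f) such that f ∈ F[t] is a polynomial
of degree ≤ d. […] Note that L₀ is just the image of the natural homomorphism WF → WE. LEMMA 5.4. In fact WF maps
bijectively to L₀. Furthermore L₀ is a retract of WE under a ring homomorphism ρ : WE → WF ≅ L₀. Proof. Choose some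
monic polynomial π of degree 1, and define ρ by the conditions ρ(u) = (ū), ρ(πu) = (ū). Here u denotes any unit with
respect to the (π)-adic valuation. It follows from Springer's theorem, applied to the (π)-adic completion, that ρ is
a well defined ring homomorphism. Since the composition WF → WE →ρ WF is the identity, this proves 5.4.»

## What is formalised (`E = F(t) = RatFunc F`, primes `𝔭 : HeightOneSpectrum F[t]`, `π = monicGen F 𝔭`)

* `WittRing.ringHom_ext` (ring homomorphisms out of `W(F)` are determined on the `(a)`); **the natural homomorphism
  `constMapW F : W(F) →+* W(F(t))`** (`= WittRing.map (algebraMap F F(t))`, `constMapW_gen`).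
* **`∂_𝔭 = boundaryAtW F 𝔭 : W(F(t)) →+ W(κ_𝔭)`** — g41-#6's `sndResidue` of the `𝔭`-adic valuation with the
  uniformizer `π = monicGen F 𝔭` (`κ_𝔭 = ResidueFieldAt F[t] F(t) 𝔭 ≅ F[t]/𝔭`): **`∂_𝔭(g) = 0` and
  `∂_𝔭(πg) = (ḡ)` for polynomials `g ∉ 𝔭`** (`boundaryAtW_gen_polyUnit`, `boundaryAtW_gen_genUnit_mul`, with
  `resUnit` = `ḡ ∈ κ_𝔭•` and `res_polyUnit`), `∂_{𝔭′}(πg) = 0` for `𝔭′ ≠ 𝔭` (`boundaryAtW_gen_genUnit_mul_of_ne`),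
  `∂_𝔭` onto (`boundaryAtW_surjective`).
* **The sequence is a complex and lands in the direct sum**: `∂_𝔭 ∘ (W(F) → W(F(t))) = 0` (`boundaryAtW_constMapW`),
  `∂_𝔭 w = 0` for all but finitely many `𝔭` (`finite_setOf_boundaryAtW_ne_zero`), the family
  `boundaryFamilyW w ∈ ⊕_𝔭 W(κ_𝔭)` (`FinSuppFamilyW`, as g40's `FinSuppFamily`).
* **LEMMA 5.4**: the degree-one prime `(t)` has residue field `F` (`constResidueEquiv : F ≃+* κ_(t)`, `g ↦ g(0)`:
  `toResidueFieldAt_primeT_eq`), the ring homomorphism **`retraction F = W(κ_(t) ≅ F) ∘ ρ_t : W(F(t)) →+* W(F)`**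
  satisfies **`retraction F (constMapW F w) = w`** («the composition WF → WE →ρ WF is the identity»), hence
  **`constMapW_injective`** («WF maps bijectively to L₀»: exactness of Theorem 5.3 at `WF`).
* On powers of the fundamental ideal (towards Lemma 5.7): `constMapW_mem_pow`, `boundaryAtW_mem_pow`
  (`∂_𝔭(Iⁿ⁺¹E) ⊂ Iⁿκ_𝔭`), `retraction_mem_pow`.
* Not here: exactness at `WE` and the joint surjectivity of `(∂_π)_π` (Theorem 5.3 proper, via Lemmas 5.5–5.6),
  Lemma 5.7.

## References

* [Milnor1970] J. Milnor, *Algebraic K-theory and quadratic forms*, Invent. Math. 9 (1970) 318–344 — §5 `∂_π` and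
  Theorem 5.3 (p0018 L5–L15), `L_d`, `L₀` and Lemma 5.4 with proof (p0018 L19–L44); Cor. 5.1 (p0017 L11–L25);
  Lemma 5.7 «0 → IⁿF → IⁿE → ⊕ Iⁿ⁻¹Ē_π → 0» and «each ∂_π maps IⁿE to Iⁿ⁻¹Ē_π» (p0021 L27–L30).
* [Knebusch2010] M. Knebusch, *Specialization of Quadratic and Symmetric Bilinear Forms*, Springer (2010) — Ch. 1
  Thm. 1.11 (PDF p. 16), the presentation of `W(K)` (for `ringHom_ext`).

Provenance: lane `lit-hodgefound`, seat `lit-hodgefound-p27` gen 41 (agent `literature-prover-lit-hodgefound-p27-g41-0`),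
row g41-#7.
-/

set_option autoImplicit false

noncomputable section

namespace Literature.RingTheory.KTheory

open Function Polynomial IsDedekindDomain

namespace WittRing

/-! ### Ring homomorphisms out of `W(F)` and the natural map `W(F) → W(F(t))` -/

section Const

variable (F : Type*) [Field F]

/-- Ring homomorphisms out of `W(F)` are determined by their values on the generators `(a)`. [cite: Knebusch2010, Ch. 1 Thm. 1.11 (PDF p. 16); Milnor1970, §5 proof of Lemma 5.4 «define ρ by the conditions ρ(u) = (ū), ρ(πu) = (ū)» (p0018 L31–L35)] -/
theorem ringHom_ext {S : Type*} [CommRing S] {f g : WittRing F →+* S} (h : ∀ a : Fˣ, f (gen F a) = g (gen F a)) :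
    f = g :=
  Ideal.Quotient.ringHom_ext (FreeCommRing.hom_ext fun a => h a)

/-- **The natural homomorphism `W(F) → W(F(t))`** («the natural homomorphism WF → WE», whose image is `L₀`). [cite: Milnor1970, §5 «Note that L₀ is just the image of the natural homomorphism WF → WE» (p0018 L25–L26); Theorem 5.3 «0 → WF → WE» (p0018 L12–L13)] -/
def constMapW : WittRing F →+* WittRing (RatFunc F) := map (algebraMap F (RatFunc F))

/-- `constMapW (a) = (a)`, the constant `a` as the polynomial unit `C a`. [cite: Milnor1970, §5 (p0018 L25–L26)] -/
theorem constMapW_gen (a : Fˣ) :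
    constMapW F (gen F a) = gen (RatFunc F) (polyUnit F (C (a : F)) (by rw [Ne, C_eq_zero]; exact a.ne_zero)) := by
  rw [constMapW, map_gen, map_algebraMap_eq_polyUnit_C]

end Const

/-! ### `∂_𝔭 : W(F(t)) → W(κ_𝔭)` -/

section BoundaryAt

variable (F : Type*) [Field F] (v : HeightOneSpectrum F[X])

/-- **`ḡ ∈ κ_𝔭•`** for a polynomial `g ∉ 𝔭` («∂_π(πu) = (ū)» read for `u = g`; `κ_𝔭 ≅ F[t]/(π)`). [cite: Milnor1970, §5 «with residue class field Ē_π = F[t]/(π)», «∂_π(πu) = (ū)» (p0018 L6–L11)] -/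
def resUnit (g : F[X]) (hgv : g ∉ v.asIdeal) : (ResidueFieldAt F[X] (RatFunc F) v)ˣ :=
  Units.mk0 (toResidueFieldAt F[X] (RatFunc F) v g) (by rwa [Ne, toResidueFieldAt_eq_zero_iff])

/-- The value of `resUnit`. [cite: Milnor1970, §5 (p0018 L6–L11)] -/
theorem coe_resUnit (g : F[X]) (hgv : g ∉ v.asIdeal) :
    ((resUnit F v g hgv : (ResidueFieldAt F[X] (RatFunc F) v)ˣ) : ResidueFieldAt F[X] (RatFunc F) v) =
      toResidueFieldAt F[X] (RatFunc F) v g := rfl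

/-- `resUnit` is multiplicative. [cite: Milnor1970, §5 (p0018 L6–L11)] -/
theorem resUnit_mul (g h : F[X]) (hgv : g ∉ v.asIdeal) (hhv : h ∉ v.asIdeal) (hghv : g * h ∉ v.asIdeal) :
    resUnit F v (g * h) hghv = resUnit F v g hgv * resUnit F v h hhv :=
  Units.ext (by rw [Units.val_mul, coe_resUnit, coe_resUnit, coe_resUnit, map_mul])

/-- **The residue of the unit part of a polynomial `g ∉ 𝔭` (with respect to any uniformizer) is `ḡ`.** [cite: Milnor1970, §5 «∂_π(πu) = (ū)», «ρ(u) = (ū)» (p0018 L11, L33)] -/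
theorem res_polyUnit {g : F[X]} (hg : g ≠ 0) (hgv : g ∉ v.asIdeal) {π : (RatFunc F)ˣ}
    (hπ : addVal (v.valuation (RatFunc F)) π = 1) :
    res (v.valuation (RatFunc F)) hπ (polyUnit F g hg) = resUnit F v g hgv := by
  rw [res_of_addVal_eq_zero _ hπ (addVal_polyUnit_eq_zero_of_not_mem F v hg hgv)]
  refine Units.ext ?_
  rw [coe_residueUnitHom, coe_resUnit, toResidueFieldAt_apply]
  congr 1

/-- **`∂_𝔭 : W(F(t)) → W(κ_𝔭)`** — the second residue homomorphism (Cor. 5.1) of the `𝔭`-adic valuation of `F(t)`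
with the uniformizer `π = monicGen F 𝔭` («Let ∂_π : WE → WĒ_π denote the composition of the natural map WE → WE_π
with the homomorphism ∂ of 5.1»; here straight out of the presented `W(F(t))`, g41-#6). [cite: Milnor1970, §5 (p0018 L9–L11); Theorem 5.3 (p0018 L12–L15)] -/
def boundaryAtW : WittRing (RatFunc F) →+ WittRing (ResidueFieldAt F[X] (RatFunc F) v) :=
  sndResidue (v.valuation (RatFunc F)) (addVal_monicGen F v)

/-- Unfolding `∂_𝔭`. [cite: Milnor1970, §5 (p0018 L9–L11)] -/
theorem boundaryAtW_def : boundaryAtW F v = sndResidue (v.valuation (RatFunc F)) (addVal_monicGen F v) := rfl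

variable {v} in
/-- **`∂_𝔭(u) = 0`** for a `𝔭`-adic unit `u`. [cite: Milnor1970, §5 «Evidently ∂_π(u) = 0» (p0018 L11)] -/
theorem boundaryAtW_gen_of_addVal_eq_zero {x : (RatFunc F)ˣ} (hx : addVal (v.valuation (RatFunc F)) x = 0) :
    boundaryAtW F v (gen (RatFunc F) x) = 0 :=
  sndResidue_gen_of_addVal_eq_zero _ _ hx

/-- **`∂_𝔭(g) = 0`** for a polynomial `g ∉ 𝔭`. [cite: Milnor1970, §5 «∂_π(u) = 0» (p0018 L11)] -/
theorem boundaryAtW_gen_polyUnit {g : F[X]} (hg : g ≠ 0) (hgv : g ∉ v.asIdeal) :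
    boundaryAtW F v (gen (RatFunc F) (polyUnit F g hg)) = 0 :=
  boundaryAtW_gen_of_addVal_eq_zero F (addVal_polyUnit_eq_zero_of_not_mem F v hg hgv)

/-- **`∂_𝔭(πg) = (ḡ)`** for the monic generator `π` of `𝔭` and a polynomial `g ∉ 𝔭`. [cite: Milnor1970, §5 «∂_π(πu) = (ū)» (p0018 L11)] -/
theorem boundaryAtW_gen_genUnit_mul {g : F[X]} (hg : g ≠ 0) (hgv : g ∉ v.asIdeal) :
    boundaryAtW F v (gen (RatFunc F) (MilnorK.genUnit F v * polyUnit F g hg)) =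
      gen (ResidueFieldAt F[X] (RatFunc F) v) (resUnit F v g hgv) := by
  rw [boundaryAtW_def, sndResidue_gen_pi_mul _ _ (addVal_polyUnit_eq_zero_of_not_mem F v hg hgv), res_polyUnit F v hg hgv]

/-- `∂_𝔭(π) = (1) = 1`. [cite: Milnor1970, §5 «∂_π(πu) = (ū)» (p0018 L11)] -/
theorem boundaryAtW_gen_genUnit : boundaryAtW F v (gen (RatFunc F) (MilnorK.genUnit F v)) = 1 := sndResidue_gen_pi _ _

variable {v} in
/-- **`∂_{𝔭′}(πg) = 0`** for `𝔭′ ≠ 𝔭` and `g ∉ 𝔭′` (`π = monicGen F 𝔭` is a `𝔭′`-unit). [cite: Milnor1970, §5 «∂_π(u) = 0» (p0018 L11); proof of Theorem 5.3 «either the identity or zero according as π = π′ or π ≠ π′» (p0020 L39–L41)] -/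
theorem boundaryAtW_gen_genUnit_mul_of_ne {w : HeightOneSpectrum F[X]} (hvw : v ≠ w) {g : F[X]} (hg : g ≠ 0)
    (hgw : g ∉ w.asIdeal) : boundaryAtW F w (gen (RatFunc F) (MilnorK.genUnit F v * polyUnit F g hg)) = 0 :=
  boundaryAtW_gen_of_addVal_eq_zero F (by
    rw [addVal_mul, addVal_polyUnit_eq_zero_of_not_mem F w (monicGen_ne_zero F v) (monicGen_not_mem_of_ne F hvw),
      addVal_polyUnit_eq_zero_of_not_mem F w hg hgw, add_zero])

/-- **`∂_𝔭` is onto** (`∂_𝔭(πg) = (ḡ)`). [cite: Milnor1970, §5 Theorem 5.3 «→ ⊕ WĒ_π → 0» (p0018 L12–L15); Cor. 5.1 (p0017 L11–L22)] -/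
theorem boundaryAtW_surjective : Function.Surjective (boundaryAtW F v) := sndResidue_surjective _ _

/-- **`∂_𝔭(Iⁿ⁺¹F(t)) ⊂ Iⁿ(κ_𝔭)`** («The proof of 5.2 shows that each ∂_π maps IⁿE to Iⁿ⁻¹Ē_π»; g41-#6's
`sndResidue_mem_pow`). [cite: Milnor1970, §5 proof of Lemma 5.7 (p0021 L27–L30)] -/
theorem boundaryAtW_mem_pow {n : ℕ} {w : WittRing (RatFunc F)} (hw : w ∈ fundIdeal (RatFunc F) ^ (n + 1)) :
    boundaryAtW F v w ∈ fundIdeal (ResidueFieldAt F[X] (RatFunc F) v) ^ n :=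
  sndResidue_mem_pow _ _ hw

/-- `W(F) → W(F(t))` carries `IⁿF` into `IⁿF(t)` («0 → IⁿF → IⁿE»). [cite: Milnor1970, §5 Lemma 5.7 (p0021 L27–L29)] -/
theorem constMapW_mem_pow {n : ℕ} {w : WittRing F} (hw : w ∈ fundIdeal F ^ n) :
    constMapW F w ∈ fundIdeal (RatFunc F) ^ n :=
  map_mem_pow_fundIdeal _ hw

/-- **`∂_𝔭 ∘ (W(F) → W(F(t))) = 0`**: constants are units at every prime — the sequence of Theorem 5.3 is a complex
at `WE`. [cite: Milnor1970, §5 Theorem 5.3 «0 → WF → WE → ⊕ WĒ_π → 0» (p0018 L12–L15)] -/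
theorem boundaryAtW_constMapW (w : WittRing F) : boundaryAtW F v (constMapW F w) = 0 := by
  have h : (boundaryAtW F v).comp (constMapW F).toAddMonoidHom = 0 := addMonoidHom_ext F fun a => by
    rw [AddMonoidHom.comp_apply, RingHom.toAddMonoidHom_eq_coe, AddMonoidHom.coe_coe, constMapW_gen,
      AddMonoidHom.zero_apply]
    exact boundaryAtW_gen_polyUnit F v _ (C_not_mem F v a.ne_zero)
  exact DFunLike.congr_fun h w

/-- **`∂_𝔭 w = 0` for all but finitely many `𝔭`** — `(∂_𝔭 w)_𝔭` lies in the DIRECT sum (a generator `(f)` has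
`v_𝔭(f) = 0` off a finite set). [cite: Milnor1970, §5 Theorem 5.3 «⊕ WĒ_π […] where the summation extends over all monic irreducible polynomials π in F[t]» (p0018 L12–L15)] -/
theorem finite_setOf_boundaryAtW_ne_zero (w : WittRing (RatFunc F)) :
    {v : HeightOneSpectrum F[X] | boundaryAtW F v w ≠ 0}.Finite := by
  have hw : w ∈ AddSubgroup.closure (Set.range (gen (RatFunc F))) := by rw [closure_range_gen]; trivial
  induction hw using AddSubgroup.closure_induction with
  | mem y hy =>
    obtain ⟨x, rfl⟩ := hy
    refine (finite_setOf_addVal_ne_zero F[X] (RatFunc F) x).subset fun v hv => ?_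
    simp only [Set.mem_setOf_eq] at hv ⊢
    exact fun h0 => hv (boundaryAtW_gen_of_addVal_eq_zero F h0)
  | zero =>
    refine Set.finite_empty.subset fun v hv => ?_
    simp only [Set.mem_setOf_eq, map_zero, ne_eq, not_true_eq_false] at hv
  | add y z _ _ hy hz =>
    refine (hy.union hz).subset fun v hv => ?_
    simp only [Set.mem_setOf_eq, Set.mem_union, map_add] at hv ⊢
    by_contra h
    simp only [not_or, not_not] at h
    exact hv (by rw [h.1, h.2, add_zero])
  | neg y _ hy =>
    refine hy.subset fun v hv => ?_
    simp only [Set.mem_setOf_eq, map_neg, ne_eq, neg_eq_zero] at hv ⊢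
    exact hv

/-- **The direct sum `⊕_𝔭 W(κ_𝔭)`** as the type of finitely supported families (as g40's `FinSuppFamily` for Milnor
`K`-theory: a bare type, no instances declared here). [cite: Milnor1970, §5 Theorem 5.3 (p0018 L12–L15)] -/
def FinSuppFamilyW : Type _ :=
  {e : (v : HeightOneSpectrum F[X]) → WittRing (ResidueFieldAt F[X] (RatFunc F) v) // {v | e v ≠ 0}.Finite}

/-- **`w ↦ (∂_𝔭 w)_𝔭 ∈ ⊕_𝔭 W(κ_𝔭)`** («These homomorphisms ∂_π give rise to …»). [cite: Milnor1970, §5 Theorem 5.3 (p0018 L12–L15)] -/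
def boundaryFamilyW (w : WittRing (RatFunc F)) : FinSuppFamilyW F :=
  ⟨fun v => boundaryAtW F v w, finite_setOf_boundaryAtW_ne_zero F w⟩

/-- The `𝔭`-component of `boundaryFamilyW w` is `∂_𝔭 w`. [cite: Milnor1970, §5 Theorem 5.3 (p0018 L12–L15)] -/
theorem boundaryFamilyW_apply (w : WittRing (RatFunc F)) (v : HeightOneSpectrum F[X]) :
    (boundaryFamilyW F w).1 v = boundaryAtW F v w := rfl

/-- The family is additive in `w` (componentwise). [cite: Milnor1970, §5 Theorem 5.3 «homomorphisms ∂_π» (p0018 L12–L15)] -/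
theorem boundaryFamilyW_add_apply (w w' : WittRing (RatFunc F)) (v : HeightOneSpectrum F[X]) :
    (boundaryFamilyW F (w + w')).1 v = (boundaryFamilyW F w).1 v + (boundaryFamilyW F w').1 v := map_add _ _ _

/-- `W(F) → W(F(t)) → ⊕_𝔭 W(κ_𝔭)` is zero. [cite: Milnor1970, §5 Theorem 5.3 (p0018 L12–L15)] -/
theorem boundaryFamilyW_constMapW (w : WittRing F) (v : HeightOneSpectrum F[X]) : (boundaryFamilyW F (constMapW F w)).1 v = 0 :=
  boundaryAtW_constMapW F v w

end BoundaryAt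

/-! ### LEMMA 5.4: the degree-one prime `(t)`, `κ_(t) ≅ F`, and the retraction `ρ` -/

section Retraction

variable (F : Type*) [Field F]

/-- `F → κ_(t)`, `a ↦ ā` (the residue class field of the degree-one prime `(t)` «is» `F`). [cite: Milnor1970, §5 proof of Lemma 5.4 «Choose some monic polynomial π of degree 1» (p0018 L31); «with residue class field Ē_π = F[t]/(π)» (p0018 L6–L8)] -/
def constResidue : F →+* ResidueFieldAt F[X] (RatFunc F) (MilnorK.primeT F) := (toResidueFieldAt F[X] (RatFunc F) (MilnorK.primeT F)).comp C

/-- Unfolding `constResidue`. [cite: Milnor1970, §5 (p0018 L6–L8, L31)] -/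
theorem constResidue_apply (a : F) : constResidue F a = toResidueFieldAt F[X] (RatFunc F) (MilnorK.primeT F) (C a) := rfl

/-- Modulo `(t)` a polynomial is its constant term: `ḡ = g(0)‾`. [cite: Milnor1970, §5 (p0018 L6–L8, L31)] -/
theorem toResidueFieldAt_primeT_eq (g : F[X]) :
    toResidueFieldAt F[X] (RatFunc F) (MilnorK.primeT F) g = constResidue F (g.coeff 0) := by
  rw [constResidue_apply, ← sub_eq_zero, ← map_sub, toResidueFieldAt_eq_zero_iff, MilnorK.mem_primeT_iff]
  exact X_dvd_sub_C

/-- `F → κ_(t)` is bijective. [cite: Milnor1970, §5 proof of Lemma 5.4 (p0018 L31–L44)] -/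
theorem constResidue_bijective : Function.Bijective (constResidue F) := by
  refine ⟨(constResidue F).injective, fun q => ?_⟩
  obtain ⟨g, rfl⟩ := toResidueFieldAt_surjective F[X] (RatFunc F) (MilnorK.primeT F) q
  exact ⟨g.coeff 0, (toResidueFieldAt_primeT_eq F g).symm⟩

/-- **`κ_(t) ≅ F`**: the residue class field of the degree-one prime `(t)` is `F`. [cite: Milnor1970, §5 proof of Lemma 5.4 «Choose some monic polynomial π of degree 1 […] ρ : WE → WF» (p0018 L30–L35)] -/
def constResidueEquiv : F ≃+* ResidueFieldAt F[X] (RatFunc F) (MilnorK.primeT F) :=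
  RingEquiv.ofBijective (constResidue F) (constResidue_bijective F)

/-- Unfolding `constResidueEquiv`. [cite: Milnor1970, §5 (p0018 L30–L35)] -/
theorem constResidueEquiv_apply (a : F) : constResidueEquiv F a = constResidue F a := rfl

/-- Lemma 5.4's `ρ` for `π = t`, valued in `W(κ_(t))`. [cite: Milnor1970, §5 Lemma 5.4 «ρ(u) = (ū), ρ(πu) = (ū)» (p0018 L31–L39)] -/
def rhoT : WittRing (RatFunc F) →+* WittRing (ResidueFieldAt F[X] (RatFunc F) (MilnorK.primeT F)) :=
  rho ((MilnorK.primeT F).valuation (RatFunc F)) (addVal_monicGen F (MilnorK.primeT F))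

/-- Unfolding `rhoT`. [cite: Milnor1970, §5 Lemma 5.4 (p0018 L31–L39)] -/
theorem rhoT_def : rhoT F = rho ((MilnorK.primeT F).valuation (RatFunc F)) (addVal_monicGen F (MilnorK.primeT F)) := rfl

/-- **LEMMA 5.4's ring homomorphism `ρ : W(F(t)) → W(F)`** («ρ(u) = (ū), ρ(πu) = (ū)» for the degree-one prime
`π = t`, followed by `W(κ_(t)) ≅ W(F)`). [cite: Milnor1970, §5 Lemma 5.4 «L₀ is a retract of WE under a ring homomorphism ρ : WE → WF ≅ L₀» and its proof (p0018 L27–L44)] -/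
def retraction : WittRing (RatFunc F) →+* WittRing F := (map (constResidueEquiv F).symm.toRingHom).comp (rhoT F)

/-- `ρ((g)) = (ḡ) = (g(0))` for a polynomial `g` prime to `t` (the class `ḡ ∈ κ_(t)` transported to `F` along `κ_(t) ≅ F`). [cite: Milnor1970, §5 Lemma 5.4 «ρ(u) = (ū)» (p0018 L33)] -/
theorem retraction_gen_polyUnit {g : F[X]} (hg : g ≠ 0) (hgv : g ∉ (MilnorK.primeT F).asIdeal) :
    retraction F (gen (RatFunc F) (polyUnit F g hg)) =
      gen F (Units.map ((constResidueEquiv F).symm : ResidueFieldAt F[X] (RatFunc F) (MilnorK.primeT F) →* F)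
        (resUnit F (MilnorK.primeT F) g hgv)) := by
  rw [retraction, RingHom.comp_apply, rhoT_def, rho_gen, res_polyUnit F (MilnorK.primeT F) hg hgv, map_gen]
  rfl

/-- **«the composition WF → WE →ρ WF is the identity».** [cite: Milnor1970, §5 proof of Lemma 5.4 (p0018 L39–L44)] -/
theorem retraction_constMapW (w : WittRing F) : retraction F (constMapW F w) = w := by
  have h : (retraction F).comp (constMapW F) = RingHom.id _ := ringHom_ext F fun a => by
    have hC : C (a : F) ≠ 0 := by rw [Ne, C_eq_zero]; exact a.ne_zero
    have hCv : C (a : F) ∉ (MilnorK.primeT F).asIdeal := C_not_mem F (MilnorK.primeT F) a.ne_zero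
    rw [RingHom.comp_apply, RingHom.id_apply, constMapW_gen, retraction_gen_polyUnit F hC hCv]
    congr 1
    refine Units.ext ?_
    rw [Units.coe_map, MonoidHom.coe_coe, coe_resUnit, ← constResidue_apply, ← constResidueEquiv_apply,
      RingEquiv.symm_apply_apply]
  exact DFunLike.congr_fun h w

/-- The retraction as an identity of ring homomorphisms. [cite: Milnor1970, §5 Lemma 5.4 (p0018 L27–L44)] -/
theorem retraction_comp_constMapW : (retraction F).comp (constMapW F) = RingHom.id _ :=
  RingHom.ext (retraction_constMapW F)

/-- `ρ` is onto. [cite: Milnor1970, §5 Lemma 5.4 «L₀ is a retract of WE» (p0018 L27–L30)] -/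
theorem retraction_surjective : Function.Surjective (retraction F) :=
  Function.RightInverse.surjective (retraction_constMapW F)

/-- **LEMMA 5.4 / THEOREM 5.3 at `WF`: `W(F) → W(F(t))` is injective** («WF maps bijectively to L₀»). [cite: Milnor1970, §5 Lemma 5.4 (p0018 L27–L28); Theorem 5.3 «0 → WF → WE» (p0018 L12–L13)] -/
theorem constMapW_injective : Function.Injective (constMapW F) :=
  Function.LeftInverse.injective (retraction_constMapW F)

/-- `ρ` carries `IⁿF(t)` into `IⁿF`. [cite: Milnor1970, §5 Lemma 5.4 (p0018 L27–L30) with Lemma 5.7 (p0021 L27–L30)] -/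
theorem retraction_mem_pow {n : ℕ} {w : WittRing (RatFunc F)} (hw : w ∈ fundIdeal (RatFunc F) ^ n) :
    retraction F w ∈ fundIdeal F ^ n := by
  rw [retraction, RingHom.comp_apply]
  exact map_mem_pow_fundIdeal _ (rho_mem_pow _ _ hw)

/-- `W(F(t)) = L₀ ⊕ ker ρ` read elementwise: `w − ι(ρ w) ∈ ker ρ`. [cite: Milnor1970, §5 Lemma 5.4 «L₀ is a retract of WE under a ring homomorphism ρ» (p0018 L27–L30)] -/
theorem retraction_sub_constMapW_retraction (w : WittRing (RatFunc F)) :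
    retraction F (w - constMapW F (retraction F w)) = 0 := by
  rw [map_sub, retraction_constMapW, sub_self]

end Retraction

end WittRing

end Literature.RingTheory.KTheory

end
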